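import Mathlib
import Literature.NumberTheory.Irrationality.BrownZudilin2022.CellularZetaFive
import Summits.KontsevichZagierPeriods.Zeta5Search.InvarianceGroup
import Summits.KontsevichZagierPeriods.Zeta5Search.WedgeDictionaryTopPairIntegral
import Summits.KontsevichZagierPeriods.Zeta5Search.WedgeDictionarySumRuleKernels
import HarnessLib

/-!
# THE LEVEL-1 SUM RULE `I(1,0,1,0,1,1,1,1) + I(1,0,1,0,1,1,0,1) = 5/6 − ζ(2)/3` (cell `pub-zeta5`, seat ct-1 g20)

HONEST FRAMING: systematic search; no irrationality claim unless certified.  An exact EVALUATION, by elementary calculus, of the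
SUM of two of Brown–Zudilin's absolutely convergent 5-fold cellular integrals [BrownZudilin2022, Sect. 1 (1)]: the axis point
`a = (1,0,1,0,1,1,1,1)` (dual `(1; 0⁷)`) and the one-top point `a = (1,0,1,0,1,1,0,1)` (dual `(1; 0,0,0,0,0,0,1)`) — the two
level-1 data `D1`, `D2` of gen-1's wedge-dictionary programme (memo `pub-zeta5-gen-1/D2-TERMINAL-g17.md` §5; human proof of this
Corollary C in `code/gen1/g17/data/LEVEL1-EXACT.md` §3 through dilogarithmic one-variable forms).  Each integral alone is a weight-5
period (`−θ + 14ζ(2)/3 + 7/3`, `θ − 5ζ(2) − 3/2` CONJECTURALLY, θ = 2ζ(5)+4ζ(3)ζ(2) — NOT proved here); their SUM is weight two: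

  integrands `t₁(t₃−t₂)(t₅−t₄)(1−t₅)/((t₃−t₁)t₃²(1−t₄)²(t₄−t₂)(t₅−t₂)²)` and `t₁(t₃−t₂)(t₅−t₄)(1−t₅)/((t₃−t₁)²t₃(1−t₄)²(t₄−t₂)(t₅−t₂)²)`
  add up to `(…)·t₁(2t₃−t₁)/(t₃²(t₃−t₁)²)`, whose `t₁`-integral `t₂²/(t₃−t₂)` is RATIONAL (the logarithms of the two separate
  `t₁`-integrations cancel); then `∫dt₃/t₃²` (rational), `∫ t₂ dt₂/(t₅−t₂)²` (one logarithm), the `t₅`-integration (polynomial ×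
  logarithm, explicit primitive) and the last `t₄`-integration, whose only transcendental input is `∫₀¹ log(1−t)/t dt = −π²/6`
  (the tree's `reDilog_one`) — value `5/6 − π²/18 = 5/6 − ζ(2)/3`.

In Lean: Tonelli through `MeasureTheory.lmarginal` exactly as in `WedgeDictionaryTopPairIntegral` (coordinates peeled in the order
`0, 2, 1, 4, 3`; one-variable kernels in `WedgeDictionarySumRuleKernels` / `…Dilog`); the two Bochner integrals are recovered from the
finite `lintegral` of the (non-negative) sum.  **`sumRule : cellularIntegral ![1,0,1,0,1,1,1,1] + cellularIntegral ![1,0,1,0,1,1,0,1]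
= 5/6 − zetaValue 2/3`.**  OUR work (Summit side); the value is not printed in [BrownZudilin2022]; nothing about `ζ(5)`, a linear form, a
denominator or an exponent.  Theorems only (points / integrands / partial integrals are local notations).
-/

noncomputable section

open MeasureTheory Set

namespace Summit.KontsevichZagierPeriods.Zeta5Search.WedgeDictionarySumRule

open Summit.KontsevichZagierPeriods.Zeta5Search.WedgeDictionaryOneTop (lintegral_t1)

open Literature.NumberTheory.Irrationality.BrownZudilin2022 (integrand cellularIntegral openSimplex b24 b14 b57 b35 b36)
open Summit.KontsevichZagierPeriods.Zeta5Search.InvarianceGroup (measurableSet_openSimplex')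
open Summit.KontsevichZagierPeriods.Zeta5Search.WedgeDictionaryTopPairIntegral (lintegral_div_sq_sub peel)
open Literature.NumberTheory.Transcendental (zetaValue)

/-- The axis point `(1,0,1,0,1,1,1,1)` (dual `(1; 0⁷)`). [folklore] -/
local notation "aAxis" => (![1, 0, 1, 0, 1, 1, 1, 1] : Fin 8 → ℤ)
/-- The one-top point `(1,0,1,0,1,1,0,1)` (dual `(1; 0,0,0,0,0,0,1)`). [folklore] -/
local notation "aOne" => (![1, 0, 1, 0, 1, 1, 0, 1] : Fin 8 → ℤ)

/-- `b₂₄(axis) = 0`. [folklore] -/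
theorem b24_aAxis : b24 aAxis = 0 := by decide
/-- `b₁₄(axis) = 1`. [folklore] -/
theorem b14_aAxis : b14 aAxis = 1 := by decide
/-- `b₅₇(axis) = 1`. [folklore] -/
theorem b57_aAxis : b57 aAxis = 1 := by decide
/-- `b₃₅(axis) = 0`. [folklore] -/
theorem b35_aAxis : b35 aAxis = 0 := by decide
/-- `b₃₆(axis) = 1`. [folklore] -/
theorem b36_aAxis : b36 aAxis = 1 := by decide
/-- `b₂₄(one-top) = 1`. [folklore] -/
theorem b24_aOne : b24 aOne = 1 := by decide
/-- `b₁₄(one-top) = 0`. [folklore] -/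
theorem b14_aOne : b14 aOne = 0 := by decide
/-- `b₅₇(one-top) = 1`. [folklore] -/
theorem b57_aOne : b57 aOne = 1 := by decide
/-- `b₃₅(one-top) = 0`. [folklore] -/
theorem b35_aOne : b35 aOne = 0 := by decide
/-- `b₃₆(one-top) = 1`. [folklore] -/
theorem b36_aOne : b36 aOne = 1 := by decide

/-- The integrand at the axis point. [folklore] -/
local notation "fAxis" => (fun t : Fin 5 → ℝ =>
  t 0 * (t 2 - t 1) * (t 4 - t 3) * (1 - t 4) / (t 2 * (1 - t 3) * (t 4 - t 1)) /
    ((t 2 - t 0) * t 2 * (1 - t 3) * (t 3 - t 1) * (t 4 - t 1)))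
/-- The integrand at the one-top point. [folklore] -/
local notation "fOne" => (fun t : Fin 5 → ℝ =>
  t 0 * (t 2 - t 1) * (t 4 - t 3) * (1 - t 4) / ((t 2 - t 0) * (1 - t 3) * (t 4 - t 1)) /
    ((t 2 - t 0) * t 2 * (1 - t 3) * (t 3 - t 1) * (t 4 - t 1)))

/-- The integrand of (1) at the axis point IS `fAxis` (all exponents `0` or `1`). [folklore] -/
theorem integrand_aAxis (t : Fin 5 → ℝ) : integrand aAxis t = fAxis t := by
  unfold integrand
  rw [b24_aAxis, b14_aAxis, b57_aAxis, b35_aAxis, b36_aAxis]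
  simp

/-- The integrand of (1) at the one-top point IS `fOne`. [folklore] -/
theorem integrand_aOne (t : Fin 5 → ℝ) : integrand aOne t = fOne t := by
  unfold integrand
  rw [b24_aOne, b14_aOne, b57_aOne, b35_aOne, b36_aOne]
  simp

/-- `fAxis` is measurable. [folklore] -/
theorem measurable_fAxis : Measurable fAxis := by fun_prop
/-- `fOne` is measurable. [folklore] -/
theorem measurable_fOne : Measurable fOne := by fun_prop

/-- The combined extended integrand. [folklore] -/
local notation "FS" => (Set.indicator openSimplex (fun t : Fin 5 → ℝ => ENNReal.ofReal (fAxis t + fOne t)))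

/-- The combined extended integrand is measurable. [folklore] -/
theorem measurable_FS : Measurable FS :=
  (ENNReal.measurable_ofReal.comp (measurable_fAxis.add measurable_fOne)).indicator measurableSet_openSimplex'

local notation "GS1" => (fun x : Fin 5 → ℝ =>
  ite (0 < x 1 ∧ x 1 < x 2 ∧ x 2 < x 3 ∧ x 3 < x 4 ∧ x 4 < 1)
    (ENNReal.ofReal (x 1 ^ 2 * (x 4 - x 3) * (1 - x 4) / (x 2 ^ 2 * (1 - x 3) ^ 2 * (x 3 - x 1) * (x 4 - x 1) ^ 2)))
    (0 : ENNReal))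
local notation "GS2" => (fun x : Fin 5 → ℝ =>
  ite (0 < x 1 ∧ x 1 < x 3 ∧ x 3 < x 4 ∧ x 4 < 1)
    (ENNReal.ofReal (x 1 * (x 4 - x 3) * (1 - x 4) / (x 3 * (1 - x 3) ^ 2 * (x 4 - x 1) ^ 2)))
    (0 : ENNReal))
local notation "GS3" => (fun x : Fin 5 → ℝ =>
  ite (0 < x 3 ∧ x 3 < x 4 ∧ x 4 < 1)
    (ENNReal.ofReal ((x 4 - x 3) * (1 - x 4) / (x 3 * (1 - x 3) ^ 2) * (x 3 / (x 4 - x 3) + Real.log ((x 4 - x 3) / x 4))))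
    (0 : ENNReal))
local notation "GS4" => (fun x : Fin 5 → ℝ =>
  ite (0 < x 3 ∧ x 3 < 1)
    (ENNReal.ofReal (1 / 2 + (1 - x 3) * Real.log (1 - x 3) / (6 * x 3) - 1 / (3 * (1 - x 3)) +
      x 3 * (x 3 - 3) * Real.log (x 3) / (6 * (1 - x 3) ^ 2)))
    (0 : ENNReal))

/-- `GS1` is measurable. [folklore] -/
theorem measurable_GS1 : Measurable GS1 := by
  refine Measurable.ite ?_ (by fun_prop) measurable_const
  measurability
/-- `GS2` is measurable. [folklore] -/
theorem measurable_GS2 : Measurable GS2 := by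
  refine Measurable.ite ?_ (by fun_prop) measurable_const
  measurability
/-- `GS3` is measurable. [folklore] -/
theorem measurable_GS3 : Measurable GS3 := by
  refine Measurable.ite ?_ (ENNReal.measurable_ofReal.comp (by fun_prop)) measurable_const
  measurability
/-- `GS4` is measurable. [folklore] -/
theorem measurable_GS4 : Measurable GS4 := by
  refine Measurable.ite ?_ (ENNReal.measurable_ofReal.comp (by fun_prop)) measurable_const
  measurability

/-- Step 0 (`t₁ ∈ (0,t₂)`, kernel `t₁(2t₃−t₁)/(t₃−t₁)²`). [folklore] -/
theorem stepS0 (x : Fin 5 → ℝ) : ∫⁻ s, FS (Function.update x 0 s) = GS1 x := by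
  have h10 : (1 : Fin 5) ≠ 0 := by decide
  have h20 : (2 : Fin 5) ≠ 0 := by decide
  have h30 : (3 : Fin 5) ≠ 0 := by decide
  have h40 : (4 : Fin 5) ≠ 0 := by decide
  by_cases hC : 0 < x 1 ∧ x 1 < x 2 ∧ x 2 < x 3 ∧ x 3 < x 4 ∧ x 4 < 1
  · obtain ⟨h1, h12, h23, h34, h4⟩ := hC
    have d21 : 0 < x 2 - x 1 := by linarith
    have d43 : 0 < x 4 - x 3 := by linarith
    have d4 : 0 < 1 - x 4 := by linarith
    have d2 : 0 < x 2 := by linarith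
    have d3 : 0 < 1 - x 3 := by linarith
    have d31 : 0 < x 3 - x 1 := by linarith
    have d41 : 0 < x 4 - x 1 := by linarith
    set K : ℝ := (x 2 - x 1) * (x 4 - x 3) * (1 - x 4) /
      (x 2 ^ 2 * (1 - x 3) ^ 2 * (x 3 - x 1) * (x 4 - x 1) ^ 2) with hKdef
    have hK : 0 ≤ K := by positivity
    have hfun : (fun s => FS (Function.update x 0 s)) =
        (Ioo 0 (x 1)).indicator (fun s => ENNReal.ofReal (K * (s * (2 * x 2 - s) / (x 2 - s) ^ 2))) := by
      funext s
      simp only [Set.indicator_apply, openSimplex, Set.mem_setOf_eq, Set.mem_Ioo,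
        Function.update_self, Function.update_of_ne h10, Function.update_of_ne h20,
        Function.update_of_ne h30, Function.update_of_ne h40]
      by_cases hs : 0 < s ∧ s < x 1
      · rw [if_pos ⟨hs.1, hs.2, h12, h23, h34, h4⟩, if_pos hs]
        congr 1
        have hs2 : x 2 - s ≠ 0 := by linarith [hs.2]
        rw [hKdef]
        field_simp
        ring
      · rw [if_neg (fun h => hs ⟨h.1, h.2.1⟩), if_neg hs]
    rw [hfun, lintegral_indicator measurableSet_Ioo, lintegral_kernel0 K (x 1) (x 2) hK h1.le h12]
    simp only [if_pos (⟨h1, h12, h23, h34, h4⟩ : 0 < x 1 ∧ x 1 < x 2 ∧ x 2 < x 3 ∧ x 3 < x 4 ∧ x 4 < 1)]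
    congr 1
    rw [hKdef]
    field_simp
  · have hfun : (fun s => FS (Function.update x 0 s)) = fun _ => 0 := by
      funext s
      simp only [Set.indicator_apply, openSimplex, Set.mem_setOf_eq,
        Function.update_self, Function.update_of_ne h10, Function.update_of_ne h20,
        Function.update_of_ne h30, Function.update_of_ne h40]
      rw [if_neg]
      intro h
      exact hC ⟨h.1.trans h.2.1, h.2.2⟩
    rw [hfun, lintegral_zero]
    simp only [if_neg hC]

/-- Step 1 (`t₃ ∈ (t₂,t₄)`, kernel `1/t₃²`). [folklore] -/
theorem stepS1 (x : Fin 5 → ℝ) : ∫⁻ s, GS1 (Function.update x 2 s) = GS2 x := by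
  have h12 : (1 : Fin 5) ≠ 2 := by decide
  have h32 : (3 : Fin 5) ≠ 2 := by decide
  have h42 : (4 : Fin 5) ≠ 2 := by decide
  by_cases hC : 0 < x 1 ∧ x 1 < x 3 ∧ x 3 < x 4 ∧ x 4 < 1
  · obtain ⟨h1, h13, h34, h4⟩ := hC
    have d43 : 0 < x 4 - x 3 := by linarith
    have d4 : 0 < 1 - x 4 := by linarith
    have d3 : 0 < 1 - x 3 := by linarith
    have d31 : 0 < x 3 - x 1 := by linarith
    have d41 : 0 < x 4 - x 1 := by linarith
    have d3' : 0 < x 3 := by linarith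
    set K : ℝ := x 1 ^ 2 * (x 4 - x 3) * (1 - x 4) / ((1 - x 3) ^ 2 * (x 3 - x 1) * (x 4 - x 1) ^ 2) with hKdef
    have hK : 0 ≤ K := by positivity
    have hfun : (fun s => GS1 (Function.update x 2 s)) =
        (Ioo (x 1) (x 3)).indicator (fun s => ENNReal.ofReal (K / (0 - s) ^ 2)) := by
      funext s
      simp only [Set.indicator_apply, Set.mem_Ioo,
        Function.update_self, Function.update_of_ne h12, Function.update_of_ne h32, Function.update_of_ne h42]
      by_cases hs : x 1 < s ∧ s < x 3
      · rw [if_pos ⟨h1, hs.1, hs.2, h34, h4⟩, if_pos hs]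
        congr 1
        have hs0 : s ≠ 0 := by linarith [hs.1]
        rw [hKdef, zero_sub, neg_sq]
        field_simp
      · rw [if_neg (fun h => hs ⟨h.2.1, h.2.2.1⟩), if_neg hs]
    rw [hfun, lintegral_indicator measurableSet_Ioo,
      lintegral_div_sq_sub K (x 1) (x 3) 0 hK h13.le (Or.inr h1)]
    simp only [if_pos (⟨h1, h13, h34, h4⟩ : 0 < x 1 ∧ x 1 < x 3 ∧ x 3 < x 4 ∧ x 4 < 1)]
    congr 1
    rw [hKdef, zero_sub, zero_sub]
    have h1' : x 1 ≠ 0 := h1.ne'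
    field_simp
    ring
  · have hfun : (fun s => GS1 (Function.update x 2 s)) = fun _ => 0 := by
      funext s
      simp only [Function.update_self, Function.update_of_ne h12, Function.update_of_ne h32,
        Function.update_of_ne h42]
      rw [if_neg]
      intro h
      exact hC ⟨h.1, h.2.1.trans h.2.2.1, h.2.2.2⟩
    rw [hfun, lintegral_zero]
    simp only [if_neg hC]

/-- Step 2 (`t₂ ∈ (0,t₄)`, kernel `t₂/(t₅−t₂)²` — the logarithm enters). [folklore] -/
theorem stepS2 (x : Fin 5 → ℝ) : ∫⁻ s, GS2 (Function.update x 1 s) = GS3 x := by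
  have h31 : (3 : Fin 5) ≠ 1 := by decide
  have h41 : (4 : Fin 5) ≠ 1 := by decide
  by_cases hC : 0 < x 3 ∧ x 3 < x 4 ∧ x 4 < 1
  · obtain ⟨h3, h34, h4⟩ := hC
    have d43 : 0 < x 4 - x 3 := by linarith
    have d4 : 0 < 1 - x 4 := by linarith
    have d3 : 0 < 1 - x 3 := by linarith
    have d4' : 0 < x 4 := by linarith
    set K : ℝ := (x 4 - x 3) * (1 - x 4) / (x 3 * (1 - x 3) ^ 2) with hKdef
    have hK : 0 ≤ K := by positivity
    have hfun : (fun s => GS2 (Function.update x 1 s)) =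
        (Ioo 0 (x 3)).indicator (fun s => ENNReal.ofReal (K * (s / (x 4 - s) ^ 2))) := by
      funext s
      simp only [Set.indicator_apply, Set.mem_Ioo,
        Function.update_self, Function.update_of_ne h31, Function.update_of_ne h41]
      by_cases hs : 0 < s ∧ s < x 3
      · rw [if_pos ⟨hs.1, hs.2, h34, h4⟩, if_pos hs]
        congr 1
        have hs4 : x 4 - s ≠ 0 := by linarith [hs.2]
        rw [hKdef]
        field_simp
      · rw [if_neg (fun h => hs ⟨h.1, h.2.1⟩), if_neg hs]
    rw [hfun, lintegral_indicator measurableSet_Ioo,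
      lintegral_t1 h3 h34 hK]
    simp only [if_pos (⟨h3, h34, h4⟩ : 0 < x 3 ∧ x 3 < x 4 ∧ x 4 < 1)]
    rw [hKdef]
  · have hfun : (fun s => GS2 (Function.update x 1 s)) = fun _ => 0 := by
      funext s
      simp only [Function.update_self, Function.update_of_ne h31, Function.update_of_ne h41]
      rw [if_neg]
      intro h
      exact hC ⟨h.1.trans h.2.1, h.2.2⟩
    rw [hfun, lintegral_zero]
    simp only [if_neg hC]

/-- Step 3 (`t₅ ∈ (t₄, 1)`, the logarithmic step). [folklore] -/
theorem stepS3 (x : Fin 5 → ℝ) : ∫⁻ s, GS3 (Function.update x 4 s) = GS4 x := by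
  have h34 : (3 : Fin 5) ≠ 4 := by decide
  by_cases hC : 0 < x 3 ∧ x 3 < 1
  · obtain ⟨h3, h31⟩ := hC
    have hfun : (fun s => GS3 (Function.update x 4 s)) =
        (Ioo (x 3) 1).indicator (fun s => ENNReal.ofReal
          ((s - x 3) * (1 - s) / (x 3 * (1 - x 3) ^ 2) * (x 3 / (s - x 3) + Real.log ((s - x 3) / s)))) := by
      funext s
      simp only [Set.indicator_apply, Set.mem_Ioo, Function.update_self, Function.update_of_ne h34]
      by_cases hs : x 3 < s ∧ s < 1
      · rw [if_pos ⟨h3, hs.1, hs.2⟩, if_pos hs]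
      · rw [if_neg (fun h => hs ⟨h.2.1, h.2.2⟩), if_neg hs]
    rw [hfun, lintegral_indicator measurableSet_Ioo, lintegral_kernel3 h3 h31]
    simp only [if_pos (⟨h3, h31⟩ : 0 < x 3 ∧ x 3 < 1)]
  · have hfun : (fun s => GS3 (Function.update x 4 s)) = fun _ => 0 := by
      funext s
      simp only [Function.update_self, Function.update_of_ne h34]
      rw [if_neg]
      intro h
      exact hC ⟨h.1, h.2.1.trans h.2.2⟩
    rw [hfun, lintegral_zero]
    simp only [if_neg hC]

/-- Step 4 (`t₄ ∈ (0, 1)`, the last integral `5/6 − π²/18`). [folklore] -/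
theorem stepS4 (x : Fin 5 → ℝ) : ∫⁻ s, GS4 (Function.update x 3 s) = ENNReal.ofReal (5 / 6 - Real.pi ^ 2 / 18) := by
  have hfun : (fun s => GS4 (Function.update x 3 s)) = (Ioo (0 : ℝ) 1).indicator (fun s => ENNReal.ofReal
      (1 / 2 + (1 - s) * Real.log (1 - s) / (6 * s) - 1 / (3 * (1 - s)) + s * (s - 3) * Real.log s / (6 * (1 - s) ^ 2))) := by
    funext s
    simp only [Set.indicator_apply, Set.mem_Ioo, Function.update_self]
  rw [hfun, lintegral_indicator measurableSet_Ioo]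
  exact lintegral_G4

/-- `∫ FS = 5/6 − π²/18` over `ℝ⁵`. [folklore] -/
theorem lintegral_FS : ∫⁻ t, FS t = ENNReal.ofReal (5 / 6 - Real.pi ^ 2 / 18) := by
  rw [MeasureTheory.volume_pi, lintegral_eq_lmarginal_univ (fun _ : Fin 5 => (0 : ℝ))]
  rw [show (Finset.univ : Finset (Fin 5)) = insert 0 {1, 2, 3, 4} from by decide,
    peel (by decide) measurable_FS stepS0,
    show ({1, 2, 3, 4} : Finset (Fin 5)) = insert 2 {1, 3, 4} from by decide,
    peel (by decide) measurable_GS1 stepS1,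
    show ({1, 3, 4} : Finset (Fin 5)) = insert 1 {3, 4} from by decide,
    peel (by decide) measurable_GS2 stepS2,
    show ({3, 4} : Finset (Fin 5)) = insert 4 {3} from by decide,
    peel (by decide) measurable_GS3 stepS3, lmarginal_singleton]
  exact stepS4 _

/-- `fAxis ≥ 0` on the open simplex. [folklore] -/
theorem fAxis_nonneg {t : Fin 5 → ℝ} (ht : t ∈ openSimplex) : 0 ≤ fAxis t := by
  obtain ⟨h0, h01, h12, h23, h34, h4⟩ := ht
  have d21 : 0 < t 2 - t 1 := by linarith
  have d43 : 0 < t 4 - t 3 := by linarith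
  have d4 : 0 < 1 - t 4 := by linarith
  have d20 : 0 < t 2 - t 0 := by linarith
  have d3 : 0 < 1 - t 3 := by linarith
  have d41 : 0 < t 4 - t 1 := by linarith
  have d2 : 0 < t 2 := by linarith
  have d31 : 0 < t 3 - t 1 := by linarith
  beta_reduce
  positivity

/-- `fOne ≥ 0` on the open simplex. [folklore] -/
theorem fOne_nonneg {t : Fin 5 → ℝ} (ht : t ∈ openSimplex) : 0 ≤ fOne t := by
  obtain ⟨h0, h01, h12, h23, h34, h4⟩ := ht
  have d21 : 0 < t 2 - t 1 := by linarith
  have d43 : 0 < t 4 - t 3 := by linarith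
  have d4 : 0 < 1 - t 4 := by linarith
  have d20 : 0 < t 2 - t 0 := by linarith
  have d3 : 0 < 1 - t 3 := by linarith
  have d41 : 0 < t 4 - t 1 := by linarith
  have d2 : 0 < t 2 := by linarith
  have d31 : 0 < t 3 - t 1 := by linarith
  beta_reduce
  positivity

/-- `5/6 − π²/18 ≥ 0`. [folklore] -/
theorem value_nonneg : 0 ≤ 5 / 6 - Real.pi ^ 2 / 18 := by
  have h := Real.pi_lt_d2
  have h0 := Real.pi_pos
  nlinarith

/-- **The level-1 sum rule** `I(1,0,1,0,1,1,1,1) + I(1,0,1,0,1,1,0,1) = 5/6 − π²/18`. [folklore] -/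
theorem sumRule_pi : cellularIntegral ![1, 0, 1, 0, 1, 1, 1, 1] + cellularIntegral ![1, 0, 1, 0, 1, 1, 0, 1] =
    5 / 6 - Real.pi ^ 2 / 18 := by
  -- the two lintegrals over the simplex
  set LA := ∫⁻ t in openSimplex, ENNReal.ofReal (fAxis t) with hLA
  set LO := ∫⁻ t in openSimplex, ENNReal.ofReal (fOne t) with hLO
  have hsum : LA + LO = ENNReal.ofReal (5 / 6 - Real.pi ^ 2 / 18) := by
    rw [hLA, hLO, ← lintegral_add_left measurable_fAxis.ennreal_ofReal,
      setLIntegral_congr_fun measurableSet_openSimplex'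
        (fun t ht => (ENNReal.ofReal_add (fAxis_nonneg ht) (fOne_nonneg ht)).symm),
      ← lintegral_indicator measurableSet_openSimplex']
    exact lintegral_FS
  have hA : LA ≠ ⊤ := by
    intro h; rw [h, top_add] at hsum; exact ENNReal.top_ne_ofReal hsum
  have hO : LO ≠ ⊤ := by
    intro h; rw [h, add_top] at hsum; exact ENNReal.top_ne_ofReal hsum
  have eA : cellularIntegral ![1, 0, 1, 0, 1, 1, 1, 1] = LA.toReal := by
    unfold cellularIntegral
    simp_rw [integrand_aAxis]
    rw [integral_eq_lintegral_of_nonneg_ae (ae_restrict_of_forall_mem measurableSet_openSimplex' fun t ht => fAxis_nonneg ht)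
      measurable_fAxis.aestronglyMeasurable]
  have eO : cellularIntegral ![1, 0, 1, 0, 1, 1, 0, 1] = LO.toReal := by
    unfold cellularIntegral
    simp_rw [integrand_aOne]
    rw [integral_eq_lintegral_of_nonneg_ae (ae_restrict_of_forall_mem measurableSet_openSimplex' fun t ht => fOne_nonneg ht)
      measurable_fOne.aestronglyMeasurable]
  rw [eA, eO, ← ENNReal.toReal_add hA hO, hsum, ENNReal.toReal_ofReal value_nonneg]

/-- **THE LEVEL-1 SUM RULE**: `I(1,0,1,0,1,1,1,1) + I(1,0,1,0,1,1,0,1) = 5/6 − ζ(2)/3` — the sum of the axis and the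
one-top cellular integrals of Brown–Zudilin's family is the WEIGHT-TWO number predicted by gen-1's wedge dictionary
(`(−θ + 14ζ(2)/3 + 7/3) + (θ − 5ζ(2) − 3/2)`), proved by elementary calculus (gen-1 g17 `LEVEL1-EXACT.md` Cor. C). [folklore] -/
theorem sumRule : cellularIntegral ![1, 0, 1, 0, 1, 1, 1, 1] + cellularIntegral ![1, 0, 1, 0, 1, 1, 0, 1] =
    5 / 6 - zetaValue 2 / 3 := by
  rw [sumRule_pi, show zetaValue 2 = Real.pi ^ 2 / 6 from hasSum_zeta_two.tsum_eq]; ring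

end Summit.KontsevichZagierPeriods.Zeta5Search.WedgeDictionarySumRule

end
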